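import Summits.BirchSwinnertonDyer.BirchSwinnertonDyer.Theorems.SignedBaseChangeAnticyclotomicEisensteinDivisibilityAdmdefHowardVanishing
import Summits.BirchSwinnertonDyer.BirchSwinnertonDyer.Theorems.SignedBaseChangeAnticyclotomicEisensteinDivisibilityAdmdefHowardMerge
import HarnessLib

/-!
# Line `admdef` (crux `AnticyclotomicEisensteinDivisibility`, stmt-BirchSwinnertonDyer-20727), rigidity road — ASSEMBLY: Howard's criterion at the
# ROOT modulo `𝔪`, in kernel modulo the `±` control at `p`: `B.HasUnitLambda N` + «`Sel^ε_1(K_0, E[p])` is a line» ⟹ `z_{0,1} ≠ 0`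

LEAD seat bsd-line-sbc-p1 (gen 28), `--supports stmt-BirchSwinnertonDyer-20727` (helper; OFF the v23 composition path).  Composition of the two halves
landed this gen: the MERGE INDUCTION `…AdmdefHowardMerge.limitBaseClass_layer_zero_one_ne_zero_of_hasUnitLambda_of_vanishing` (a unit `λ` at any
definite vertex and any depth + rank-one bottom Selmer line ⟹ `z_{0,1} ≠ 0`, modulo the vanishing lemma (HV)) and the VANISHING LEMMA
`…AdmdefHowardVanishing.eq_zero_of_mem_signedOrdSelmerTorsion_of_isUnit_lam` ((HV) from the tree's Tate reciprocity, modulo (CTRL) and (RAM)).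
RESULT (`limitBaseClass_layer_zero_one_ne_zero_of_hasUnitLambda`): for a signed bipartite system `B` of sign `ε` at level `N = N_E`
(CHKLL25 Thm. 7.4 as typed) on the cell-β frame (`p ≥ 5`, `ρ̄_{E,p}` onto, `K` imaginary quadratic, `N_E` Heegner, `p` split, `κ` anticyclotomic)
with limit base class `z`:
  `B.HasUnitLambda N` [Howard's criterion [NV], CHKLL25 Thm. 7.5 «Moreover»]
  ∧ (CTRL) [layer-0 signed condition ⟹ Kummer at `v ∣ p`; half of B.-D. Kim 2007 Prop. 4.18 — HYPOTHESIS, not in the tree]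
  ∧ (RAM) [`E[p]` ramified at the bad places `v ∤ p`; CHKLL25 Thm. 7.1 (ii) in `K`-currency — HYPOTHESIS]
  ∧ `Sel^ε_1(K_0, E[p]) = 𝔽_p · s`, `s ≠ 0` [the bottom signed Selmer group at the root is a LINE]
  ⟹ `z_{0,1} ≠ 0` (the bottom class of the `Λ`-adic base class is non-zero) — [Howard2006] Thm. 3.2.3 (c) ∕ BCK21 Prop. 7.4 read at the root modulo
`𝔪 = (p, T)`, the statement the line's records (RV₁)H / (RV₁)H-pinned (`Lines/admdef.lean` v22) ask for, now CONDITIONAL ONLY on (CTRL), (RAM) and the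
rank-one hypothesis in CHKLL25's currency.  Also the `κ_1(1)_0` form.

HONEST FRAMING: theorems only (no definition, no named fact, no `sorry`); (CTRL), (RAM), `HasUnitLambda`, the rank-one line are HYPOTHESES; nothing
about the crux, the anchors (K1) or BSD is asserted.  What separates this from the v22 record (RV₁)H: the dictionary `Sel^ε_1(K_0, E[p]) ↔
Sel_p(E/K)[p]` (needs (CTRL) in both directions and the bad-place comparison unramified ↔ Kummer) and (CTRL)/(RAM) themselves.

References: [cite: Howard2006, Thm. 3.2.3 (c), Lem. 2.3.3–2.3.4] [cite: BurungaleCastellaKim2021, arXiv:1908.09512 Prop. 7.4, Lem. 7.3]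
[cite: CastellaEtAl2025, Thm. 7.4, Thm. 7.5 (arXiv:2308.10474v2 pp. 30–31)] [cite: BertoliniDarmon2005, Thm. 4.1 (proof)] [cite: BDKim2013, §3].
-/

-- D-0017: single-problem summit, the namespace repeats the problem name by design.
set_option linter.dupNamespace false
set_option autoImplicit false

noncomputable section

open scoped Classical NumberField

namespace Summit.BirchSwinnertonDyer.BirchSwinnertonDyer.Theorems.SignedBaseChangeAcDivAdmdefHowardRigidityRoot

open WeierstrassCurve NumberField IsDedekindDomain Field
open Literature.NumberTheory.EllipticCurves Literature.NumberTheory.GaloisRepresentations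
open Literature.NumberTheory.EllipticCurves.CastellaHsuKunduLeeLiu2025
open Literature.NumberTheory.EllipticCurves.BertoliniDarmon2005
open Literature.NumberTheory.EllipticCurves.AcSigned
open Summit.BirchSwinnertonDyer.BirchSwinnertonDyer.Theorems.AdditiveKoly
open Summit.BirchSwinnertonDyer.BirchSwinnertonDyer.Theorems.SignedBaseChangeAcDivAdmdefCoreRootOfSeenAnchor
open Summit.BirchSwinnertonDyer.BirchSwinnertonDyer.Theorems.SignedBaseChangeAcDivAdmdefHowardMerge
open Summit.BirchSwinnertonDyer.BirchSwinnertonDyer.Theorems.SignedBaseChangeAcDivAdmdefHowardVanishing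

universe u

variable {K : Type} [Field K] [NumberField K] {W : WeierstrassCurve ℚ} [W.IsElliptic] [W.IsGloballyMinimal] {p : ℕ} [Fact p.Prime]
  {κ : ZpExtension K p} {γ : absoluteGaloisGroup K} {N : ℕ} {ε : ℤˣ} {B : SignedBipartiteSystem W K p κ}

/-- **Howard's criterion at the root, bottom layer, `κ` form** — unit `λ` anywhere + (CTRL) + (RAM) + rank-one bottom signed Selmer line ⟹
`κ_1(1)_0 ≠ 0`. (`…HowardMerge.kappa_one_layer_zero_ne_zero_of_isUnit_lam_of_vanishing` with (HV) supplied by `…HowardVanishing`.)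
[cite: Howard2006, Thm. 3.2.3 (c)] [cite: CastellaEtAl2025, Thm. 7.5 (arXiv:2308.10474v2 p0031 L13–L20)] -/
theorem kappa_one_layer_zero_ne_zero_of_isUnit_lam (hB : IsSignedBipartiteSystem W K p κ γ N ε B)
    (hN : (N : ℤ) = W.conductorNorm ℤ) (h5 : 5 ≤ p) (hsurj : W.HasSurjectiveModNGaloisRep p) (hK : IsImaginaryQuadratic K)
    (hH : SatisfiesHeegnerHypothesis (W.conductorNorm ℤ) K) (hsp : ((Ideal.span {(p : ℤ)}).primesOver (𝓞 K)).ncard = 2)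
    (hκ : κ.IsAnticyclotomic)
    (hctrl : ∀ v : HeightOneSpectrum (𝓞 K), ((p : ℕ) : 𝓞 K) ∈ v.asIdeal → ∀ X : Vp W K p,
      resH1Hom (Literature.NumberTheory.EllipticCurves.subgroupIncl (κ.layerSubgroup 0))
          (AddSubgroup.inclusion (geomTorsion_natCast_pow_one W (K := K) (p := p)).le) (fun _ _ ↦ rfl) X ∈
        condAboveTorsion (W.baseChange K) p κ v (.sgn ε) 0 1 →
      X ∈ selmerLocalKer (W.baseChange K) (v.adicCompletion K) ((p ^ 1 : ℕ) : ℤ))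
    (hram : ∀ v : HeightOneSpectrum (𝓞 K), ¬ (W.baseChange K).HasGoodReductionAt v → ((p : ℕ) : 𝓞 K) ∉ v.asIdeal →
      ∃ 𝔓 ∈ v.primesAbove, ∃ τ ∈ 𝔓.inertia (absoluteGaloisGroup K), ∃ P : geomTorsion (W.baseChange K) ((p ^ 1 : ℕ) : ℤ), τ • P ≠ P)
    {s : (W.baseChange K).torsionH1Over ((p : ℤ) ^ 1) (κ.layerSubgroup 0)}
    (hs : s ∈ signedOrdSelmerTorsion (W.baseChange K) p κ ε 1 0 1) (hs0 : s ≠ 0)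
    (hline : ∀ c ∈ signedOrdSelmerTorsion (W.baseChange K) p κ ε 1 0 1, ∃ a : ℤ, c = a • s)
    {n₀ : ℕ} (hn₀ : n₀ ∈ defProducts N K (fun ℓ ↦ W.frobeniusTrace ℓ) p 1)
    (hlam : IsUnit (PowerSeries.constantCoeff (B.lam 1 n₀))) : B.kappa 1 1 0 ≠ 0 :=
  kappa_one_layer_zero_ne_zero_of_isUnit_lam_of_vanishing hB hN hK hκ
    (fun _ hn hlamn c hc ↦ eq_zero_of_mem_signedOrdSelmerTorsion_of_isUnit_lam hB hN h5 hsurj hK hH hsp hκ hctrl hram hn hlamn c hc)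
    hs hs0 hline hn₀ hlam

/-- **Howard's criterion at the root modulo `𝔪`, in kernel modulo the `±` control** — `B.HasUnitLambda N` + (CTRL) + (RAM) + rank-one bottom signed
Selmer line ⟹ `z_{0,1} ≠ 0` for the limit base class `z` of `B` (`B.IsLimitBaseClass z`).  The composition of the gen-28 rigidity road:
`…HowardMerge` (merge induction, depth lowered by g16's `hasUnitLambda_iff_level_one`) ∘ `…HowardVanishing` ((HV) from Tate reciprocity).
[cite: Howard2006, Thm. 3.2.3 (c)] [cite: BurungaleCastellaKim2021, arXiv:1908.09512 Prop. 7.4] [cite: CastellaEtAl2025, Thm. 7.5 (arXiv:2308.10474v2 p0031 L13–L20)] -/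
theorem limitBaseClass_layer_zero_one_ne_zero_of_hasUnitLambda (hB : IsSignedBipartiteSystem W K p κ γ N ε B)
    {z : Π n j : ℕ, (W.baseChange K).torsionH1Over ((p : ℤ) ^ j) (κ.layerSubgroup n)} (hz : B.IsLimitBaseClass z)
    (hN : (N : ℤ) = W.conductorNorm ℤ) (h5 : 5 ≤ p) (hsurj : W.HasSurjectiveModNGaloisRep p) (hK : IsImaginaryQuadratic K)
    (hH : SatisfiesHeegnerHypothesis (W.conductorNorm ℤ) K) (hsp : ((Ideal.span {(p : ℤ)}).primesOver (𝓞 K)).ncard = 2)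
    (hκ : κ.IsAnticyclotomic)
    (hctrl : ∀ v : HeightOneSpectrum (𝓞 K), ((p : ℕ) : 𝓞 K) ∈ v.asIdeal → ∀ X : Vp W K p,
      resH1Hom (Literature.NumberTheory.EllipticCurves.subgroupIncl (κ.layerSubgroup 0))
          (AddSubgroup.inclusion (geomTorsion_natCast_pow_one W (K := K) (p := p)).le) (fun _ _ ↦ rfl) X ∈
        condAboveTorsion (W.baseChange K) p κ v (.sgn ε) 0 1 →
      X ∈ selmerLocalKer (W.baseChange K) (v.adicCompletion K) ((p ^ 1 : ℕ) : ℤ))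
    (hram : ∀ v : HeightOneSpectrum (𝓞 K), ¬ (W.baseChange K).HasGoodReductionAt v → ((p : ℕ) : 𝓞 K) ∉ v.asIdeal →
      ∃ 𝔓 ∈ v.primesAbove, ∃ τ ∈ 𝔓.inertia (absoluteGaloisGroup K), ∃ P : geomTorsion (W.baseChange K) ((p ^ 1 : ℕ) : ℤ), τ • P ≠ P)
    {s : (W.baseChange K).torsionH1Over ((p : ℤ) ^ 1) (κ.layerSubgroup 0)}
    (hs : s ∈ signedOrdSelmerTorsion (W.baseChange K) p κ ε 1 0 1) (hs0 : s ≠ 0)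
    (hline : ∀ c ∈ signedOrdSelmerTorsion (W.baseChange K) p κ ε 1 0 1, ∃ a : ℤ, c = a • s)
    (hNV : B.HasUnitLambda N) : z 0 1 ≠ 0 :=
  limitBaseClass_layer_zero_one_ne_zero_of_hasUnitLambda_of_vanishing hB hz hN hK hκ
    (fun _ hn hlamn c hc ↦ eq_zero_of_mem_signedOrdSelmerTorsion_of_isUnit_lam hB hN h5 hsurj hK hH hsp hκ hctrl hram hn hlamn c hc)
    hs hs0 hline hNV

end Summit.BirchSwinnertonDyer.BirchSwinnertonDyer.Theorems.SignedBaseChangeAcDivAdmdefHowardRigidityRoot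

end
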